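import Summits.Ventures.PercRepro.SevenThreePlane

/-!
# PercRepro — the `(7,3)` cell: the naive demand of a positive-type plane (p3, gen 16; offered to night-3 for (R6)(e))

For a plane `G` with `t = 7 − ρ(E ∖ G)`, a demand `B ∈ U_G` (`ρ(B) = 3`, `ρ(E ∖ B) = 7`) has at most `|G| − t` points:
`ρ(E ∖ B) ≤ ρ(E ∖ G) + |G ∖ B|` (`card_le_of_mem_UqG`). Hence `#U_G ≤ #{B ∈ R₃(G) : |B| + t ≤ |G|}`
(`card_UqG_le_naive`) — the NAIVE DEMAND of mine-2's cells (INBOX 5152 (e)).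
-/

namespace PercRepro

namespace SevenThree

open Finset ThmH SixThree PerFlat

variable {α : Type*} [DecidableEq α] {M : Matroid α} [M.Finite]

/-- `ρ(E ∖ B) ≤ ρ(E ∖ G) + |G ∖ B|`. -/
theorem eRk_sdiff_le_of_subset (G B : Finset α) :
    M.eRk ((gr M \ B : Finset α) : Set α) ≤ M.eRk ((gr M \ G : Finset α) : Set α) + ((G \ B).card : ℕ∞) := by
  have h1 : gr M \ B ⊆ (gr M \ G) ∪ (G \ B) := by
    intro e he
    rw [Finset.mem_sdiff] at he
    rw [Finset.mem_union, Finset.mem_sdiff, Finset.mem_sdiff]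
    by_cases hG : e ∈ G
    · exact Or.inr ⟨hG, he.2⟩
    · exact Or.inl ⟨he.1, hG⟩
  calc M.eRk ((gr M \ B : Finset α) : Set α)
      ≤ M.eRk (((gr M \ G) ∪ (G \ B) : Finset α) : Set α) := M.eRk_mono (Finset.coe_subset.2 h1)
    _ = M.eRk (((gr M \ G : Finset α) : Set α) ∪ ((G \ B : Finset α) : Set α)) := by rw [Finset.coe_union]
    _ ≤ M.eRk ((gr M \ G : Finset α) : Set α) + ((G \ B : Finset α) : Set α).encard :=
        M.eRk_union_le_eRk_add_encard _ _
    _ = M.eRk ((gr M \ G : Finset α) : Set α) + ((G \ B).card : ℕ∞) := by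
        rw [Set.encard_coe_eq_coe_finsetCard]

/-- **A demand of a plane of positive type is small**: for `B ∈ U_G` and `t = 7 − ρ(E ∖ G)` (as `ρ(E ∖ G) + t = 7`),
`|B| + t ≤ |G|`. -/
theorem card_le_of_mem_UqG {G B : Finset α} (hB : B ∈ UqG M 7 3 G) {t : ℕ}
    (ht : M.eRk ((gr M \ G : Finset α) : Set α) + (t : ℕ∞) = 7) : B.card + t ≤ G.card := by
  obtain ⟨⟨-, -, hrB⟩, hBG⟩ := mem_UqG_seven_three.1 hB
  have h1 := eRk_sdiff_le_of_subset (M := M) G B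
  rw [hrB] at h1
  obtain ⟨r, hr, -⟩ := eRk_eq_nat M (gr M \ G)
  rw [hr] at h1 ht
  have h2 : 7 ≤ r + (G \ B).card := by exact_mod_cast h1
  have h3 : r + t = 7 := by exact_mod_cast ht
  have h4 := Finset.card_sdiff_of_subset hBG
  have h5 := Finset.card_le_card hBG
  omega

open scoped Classical in
/-- **The naive demand**: `#U_G ≤ #{B ∈ R₃(G) : |B| + t ≤ |G|}`. -/
theorem card_UqG_le_naive {G : Finset α} {t : ℕ} (ht : M.eRk ((gr M \ G : Finset α) : Set α) + (t : ℕ∞) = 7) :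
    (UqG M 7 3 G).card ≤ ((R3 M G).filter (fun B => B.card + t ≤ G.card)).card := by
  apply Finset.card_le_card
  intro B hB
  rw [Finset.mem_filter]
  obtain ⟨⟨-, hrB, -⟩, hBG⟩ := mem_UqG_seven_three.1 hB
  refine ⟨?_, card_le_of_mem_UqG hB ht⟩
  unfold R3
  rw [Finset.mem_filter, Finset.mem_powerset]
  exact ⟨hBG, hrB⟩

end SevenThree

end PercRepro
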